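import Literature.Analysis.OperatorTheory.KreinStewartNegSquares

/-!
# Kreĭn–Stewart definitization: the finite-dimensional theorem

`KreinStewart.fd`: on a finite-dimensional complex space with a Hermitian form with at most `κ`
negative squares, every symmetric operator `A` admits a non-zero polynomial `P` of degree `≤ κ`
with `Re B (P(A)x) (P(A)x) ≥ 0` — the elementary replacement (induction on the dimension through
one eigenvector of `A`, `KreinStewart.crux`) for Pontryagin's invariant-subspace theorem used in
Stewart 1972, proof of Thm. 3.1. See `KreinStewartDefs` for the overview.
-/

open scoped ComplexConjugate
open Module Polynomial

namespace Literature.Analysis.OperatorTheory.KreinStewart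

variable {V : Type*} [AddCommGroup V] [Module ℂ V] {B : HForm V}

/-- Coercion of polynomials of a restricted endomorphism. [folklore] -/
theorem coe_aeval_restrict {A : V →ₗ[ℂ] V} {p : Submodule ℂ V} (hA : ∀ x ∈ p, A x ∈ p)
    (P : ℂ[X]) (y : p) : ((aeval (A.restrict hA) P) y : V) = aeval A P (y : V) := by
  induction P using Polynomial.induction_on' with
  | add P Q hP hQ => simp [hP, hQ]
  | monomial n c =>
    simp only [aeval_monomial, Module.End.mul_apply, Module.algebraMap_end_apply,
      Submodule.coe_smul, Module.End.pow_restrict n hA, LinearMap.coe_restrict_apply]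

/-- The range of `A - conj μ` is orthogonal to an eigenvector `e` (`A e = μ e`) of a symmetric
`A`. [folklore] -/
theorem range_subset_orth {A : V →ₗ[ℂ] V} (hA : IsSymOp B A) {e : V} {μ : ℂ}
    (hAe : A e = μ • e) :
    Set.range ⇑(A - (conj μ) • (1 : Module.End ℂ V)) ⊆ {x | B e x = 0} := by
  rintro _ ⟨x, rfl⟩
  simp only [Set.mem_setOf_eq, LinearMap.sub_apply, LinearMap.smul_apply, Module.End.one_apply,
    map_sub, map_smul, smul_eq_mul]
  rw [← hA e x, hAe, LinearMap.map_smulₛₗ₂, smul_eq_mul, sub_self]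

/-- The compression `π ∘ A|E₁` of a symmetric operator to a complement `E₁ ⊥ e`, along `e`, is
symmetric. [folklore] -/
theorem isSymOp_compress (hB : B.IsSymm) {A : V →ₗ[ℂ] V} (hA : IsSymOp B A) {e : V}
    (E₁ : Submodule ℂ V) (hE₁ : ∀ m ∈ E₁, B e m = 0) (π : V →ₗ[ℂ] E₁)
    (hπ : ∀ x, ∃ α : ℂ, x = π x + α • e) :
    IsSymOp (pb B E₁.subtype) (π ∘ₗ A ∘ₗ E₁.subtype) := by
  intro m m'
  simp only [pb_apply, LinearMap.coe_comp, Function.comp_apply, Submodule.coe_subtype]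
  obtain ⟨α, hα⟩ := hπ (A m)
  obtain ⟨α', hα'⟩ := hπ (A m')
  have h1 : B (A m) m' = B (π (A m) : V) m' := by
    conv_lhs => rw [hα]
    rw [LinearMap.map_add₂, LinearMap.map_smulₛₗ₂, hE₁ _ m'.2, smul_zero, add_zero]
  have h2 : B (m : V) (A m') = B (m : V) (π (A m') : V) := by
    conv_lhs => rw [hα']
    rw [map_add, map_smul, apply_eq_zero_comm hB (hE₁ _ m.2), smul_zero, add_zero]
  rw [← h1, ← h2, hA]

/-- Transfer of the inductive conclusion from the compression back to `V`. [folklore] -/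
theorem crux_transfer (hB : B.IsSymm) {κ : ℕ} {A : V →ₗ[ℂ] V} {e : V} {μ : ℂ} (hAe : A e = μ • e)
    (he : 0 ≤ (B e e).re) (E₁ : Submodule ℂ V) (hE₁ : ∀ m ∈ E₁, B e m = 0) (π : V →ₗ[ℂ] E₁)
    (hπ : ∀ x, ∃ α : ℂ, x = π x + α • e) {lam : ℂ}
    (h1 : NegSqLEOn (pb B E₁.subtype) κ
      (Set.range ⇑((π ∘ₗ A ∘ₗ E₁.subtype) - lam • (1 : Module.End ℂ E₁)))) :
    NegSqLEOn B κ (Set.range ⇑(A - lam • (1 : Module.End ℂ V))) := by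
  intro u hu
  choose y hy using hu
  choose α hα using fun a => hπ (y a)
  choose α' hα' using fun a => hπ (A (π (y a) : V))
  set m : Fin (κ + 1) → E₁ := fun a => ((π ∘ₗ A ∘ₗ E₁.subtype) - lam • (1 : Module.End ℂ E₁))
    (π (y a)) with hmdef
  obtain ⟨w, hw, hpos⟩ := h1 m (fun a => ⟨π (y a), rfl⟩)
  refine ⟨w, hw, ?_⟩
  have hum : ∀ a, u a = (m a : V) + (α' a + α a * μ - lam * α a) • e := by
    intro a
    rw [← hy a, LinearMap.sub_apply, LinearMap.smul_apply, Module.End.one_apply]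
    conv_lhs => rw [hα a]
    rw [map_add, map_smul, hAe, hα' a, hmdef]
    simp only [LinearMap.sub_apply, LinearMap.smul_apply, Module.End.one_apply,
      LinearMap.coe_comp, Function.comp_apply, Submodule.coe_subtype, Submodule.coe_sub,
      Submodule.coe_smul]
    module
  have hsum : ∑ a, w a • u a
      = (∑ a, w a • (m a : V)) + (∑ a, w a * (α' a + α a * μ - lam * α a)) • e := by
    rw [Finset.sum_smul, ← Finset.sum_add_distrib]
    refine Finset.sum_congr rfl fun a _ => ?_
    rw [hum a, smul_add, smul_smul]
  have horth : B e (∑ a, w a • (m a : V)) = 0 := by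
    rw [apply_right_sum_smul]
    simp [hE₁ _ (m _).2]
  have hval : pb B E₁.subtype (∑ a, w a • m a) (∑ a, w a • m a)
      = B (∑ a, w a • (m a : V)) (∑ a, w a • (m a : V)) := by
    simp [pb_apply]
  rw [hval] at hpos
  rw [hsum, apply_add_smul_self hB horth, Complex.add_re, Complex.re_ofReal_mul]
  have h0 : 0 ≤ Complex.normSq (∑ a, w a * (α' a + α a * μ - lam * α a)) := Complex.normSq_nonneg _
  nlinarith

universe u

/-- **Key finite-dimensional step.** If `B` (on a finite-dimensional space) has at most `κ + 1`
but not at most `κ` negative squares and `A` is `B`-symmetric, then for some `λ` the range of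
`A - λ` has at most `κ` negative squares. (Elementary replacement for Pontryagin's invariant
subspace theorem; induction on the dimension via an eigenvector of `A`.) [folklore] -/
theorem crux (n : ℕ) : ∀ {E : Type u} [AddCommGroup E] [Module ℂ E] [FiniteDimensional ℂ E]
    {B : HForm E} (_hB : B.IsSymm) {A : E →ₗ[ℂ] E} (_hA : IsSymOp B A) {κ : ℕ},
    finrank ℂ E ≤ n → NegSqLE B (κ + 1) → ¬ NegSqLE B κ →
    ∃ lam : ℂ, NegSqLEOn B κ (Set.range ⇑(A - lam • (1 : Module.End ℂ E))) := by
  induction n with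
  | zero =>
    intro E _ _ _ B hB A hA κ hn h hn'
    exfalso
    haveI := nontrivial_of_not_negSqLE hn'
    have := Module.finrank_pos (R := ℂ) (M := E)
    omega
  | succ n ih =>
    intro E _ _ _ B hB A hA κ hn h hn'
    haveI := nontrivial_of_not_negSqLE hn'
    obtain ⟨μ, hμ⟩ := Module.End.exists_eigenvalue A
    obtain ⟨e, he⟩ := hμ.exists_hasEigenvector
    have hAe : A e = μ • e := he.apply_eq_smul
    have he0 : e ≠ 0 := he.2
    have hran := range_subset_orth hA hAe
    by_cases hneg : (B e e).re < 0
    · exact ⟨conj μ, (NegSqLEOn.ker_of_neg hB h hneg).mono hran⟩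
    by_cases hiso : B e e = 0 ∧ ∃ f, B e f ≠ 0
    · obtain ⟨hee, f, hf⟩ := hiso
      exact ⟨conj μ, (NegSqLEOn.ker_of_isotropic hB h hee hf).mono hran⟩
    have hge : 0 ≤ (B e e).re := le_of_not_gt hneg
    -- a complement `E₁` of `e`, orthogonal to `e`, with the projection `π` along `e`
    obtain ⟨E₁, hE₁, heE, π, hπ⟩ : ∃ E₁ : Submodule ℂ E, (∀ m ∈ E₁, B e m = 0) ∧ e ∉ E₁ ∧
        ∃ π : E →ₗ[ℂ] E₁, ∀ x, ∃ α : ℂ, x = π x + α • e := by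
      by_cases hee : B e e = 0
      · have hrad : ∀ f, B e f = 0 := by
          by_contra hcon
          push Not at hcon
          exact hiso ⟨hee, hcon⟩
        obtain ⟨E₁, hc⟩ := Submodule.exists_isCompl (ℂ ∙ e)
        refine ⟨E₁, fun m _ => hrad m, ?_, E₁.projectionOnto (ℂ ∙ e) hc.symm, ?_⟩
        · intro heE
          have : e ∈ (ℂ ∙ e) ⊓ E₁ := ⟨Submodule.mem_span_singleton_self e, heE⟩
          rw [hc.inf_eq_bot, Submodule.mem_bot] at this
          exact he0 this
        · intro x
          have hx := Submodule.sub_projection_mem hc.symm x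
          rw [Submodule.mem_span_singleton] at hx
          obtain ⟨α, hα⟩ := hx
          refine ⟨α, ?_⟩
          rw [hα, Submodule.coe_projectionOnto_apply]
          abel
      · refine ⟨LinearMap.ker (B e), fun m hm => hm, ?_, ?_⟩
        · intro heE
          exact hee heE
        · refine ⟨LinearMap.codRestrict (LinearMap.ker (B e))
            (LinearMap.id - (B e e)⁻¹ • ((LinearMap.id : ℂ →ₗ[ℂ] ℂ).smulRight e ∘ₗ B e)) ?_, ?_⟩
          · intro x
            simp only [LinearMap.mem_ker, LinearMap.sub_apply, LinearMap.id_apply,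
              LinearMap.smul_apply, LinearMap.coe_comp, Function.comp_apply,
              LinearMap.smulRight_apply, map_sub, map_smul, smul_eq_mul]
            field_simp
            ring
          · intro x
            refine ⟨(B e e)⁻¹ * B e x, ?_⟩
            simp only [LinearMap.codRestrict_apply, LinearMap.sub_apply, LinearMap.id_apply,
              LinearMap.smul_apply, LinearMap.coe_comp, Function.comp_apply,
              LinearMap.smulRight_apply, smul_smul]
            abel
    -- induction hypothesis on `E₁`
    have hlt : finrank ℂ E₁ < finrank ℂ E :=
      Submodule.finrank_lt fun htop => heE (htop ▸ Submodule.mem_top)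
    obtain ⟨lam, hlam⟩ := ih (isSymm_pb hB E₁.subtype) (isSymOp_compress hB hA E₁ hE₁ π hπ)
      (κ := κ) (by omega) (h.comap E₁.subtype) (not_negSqLE_of_proj hB hn' hge E₁ hE₁ π hπ)
    exact ⟨lam, crux_transfer hB hAe hge E₁ hE₁ π hπ hlam⟩

/-- **Finite-dimensional definitization.** If `B` has at most `κ` negative squares on a
finite-dimensional space and `A` is `B`-symmetric, there is a non-zero polynomial `P` of degree
at most `κ` with `Re B (P(A)x) (P(A)x) ≥ 0` for all `x`. [folklore] -/
theorem fd (κ : ℕ) : ∀ {E : Type u} [AddCommGroup E] [Module ℂ E] [FiniteDimensional ℂ E]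
    {B : HForm E} (_hB : B.IsSymm) {A : E →ₗ[ℂ] E} (_hA : IsSymOp B A), NegSqLE B κ →
    ∃ P : ℂ[X], P ≠ 0 ∧ P.natDegree ≤ κ ∧ ∀ x, 0 ≤ (B (aeval A P x) (aeval A P x)).re := by
  induction κ with
  | zero =>
    intro E _ _ _ B hB A hA h
    refine ⟨1, one_ne_zero, by simp, fun x => ?_⟩
    simpa using h.nonneg x
  | succ κ ih =>
    intro E _ _ _ B hB A hA h
    by_cases hκ : NegSqLE B κ
    · obtain ⟨P, hP0, hPdeg, hP⟩ := ih hB hA hκ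
      exact ⟨P, hP0, hPdeg.trans (Nat.le_succ κ), hP⟩
    obtain ⟨lam, hlam⟩ := crux (finrank ℂ E) hB hA le_rfl h hκ
    set M : Submodule ℂ E := LinearMap.range (A - lam • (1 : Module.End ℂ E)) with hMdef
    have hAM : ∀ x ∈ M, A x ∈ M := by
      rintro _ ⟨y, rfl⟩
      refine ⟨A y, ?_⟩
      simp only [LinearMap.sub_apply, LinearMap.smul_apply, Module.End.one_apply, map_sub,
        map_smul]
    have hsym : IsSymOp (pb B M.subtype) (A.restrict hAM) := by
      intro x y
      simp only [pb_apply, Submodule.coe_subtype, LinearMap.coe_restrict_apply]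
      exact hA x y
    have hM : NegSqLE (pb B M.subtype) κ := by
      intro u _
      obtain ⟨w, hw, hpos⟩ := hlam (fun a => (u a : E)) (fun a => (u a).2)
      refine ⟨w, hw, ?_⟩
      simpa [pb_apply] using hpos
    obtain ⟨P₁, hP₁0, hP₁deg, hP₁⟩ := ih (isSymm_pb hB M.subtype) hsym hM
    refine ⟨P₁ * (X - Polynomial.C lam), mul_ne_zero hP₁0 (X_sub_C_ne_zero lam), ?_, fun x => ?_⟩
    · rw [natDegree_mul hP₁0 (X_sub_C_ne_zero lam), natDegree_X_sub_C]
      omega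
    · have hy : aeval A (X - Polynomial.C lam) x ∈ M := ⟨x, by
        simp [LinearMap.sub_apply, Module.End.one_apply, Algebra.algebraMap_eq_smul_one]⟩
      have key := hP₁ ⟨aeval A (X - Polynomial.C lam) x, hy⟩
      rw [pb_apply, Submodule.coe_subtype, coe_aeval_restrict] at key
      rw [map_mul, Module.End.mul_apply]
      exact key

end Literature.Analysis.OperatorTheory.KreinStewart
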